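import Summits.BirchSwinnertonDyer.BirchSwinnertonDyer.Theorems.ManinLocalTwoThreeLigozatIdentitiesTwentySeven
import Summits.BirchSwinnertonDyer.BirchSwinnertonDyer.Theorems.ManinLocalTwoThreeLigozatIdentitiesThirtyTwo
import Summits.BirchSwinnertonDyer.BirchSwinnertonDyer.Theorems.ManinLocalTwoThreeHeckeThetaTwentySeven
import Summits.BirchSwinnertonDyer.BirchSwinnertonDyer.Theorems.ManinLocalTwoThreeHeckeThetaThirtySix
import Summits.BirchSwinnertonDyer.BirchSwinnertonDyer.Theorems.ManinLocalTwoThreeManinOddAtFourInhabited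
import Summits.BirchSwinnertonDyer.BirchSwinnertonDyer.Theorems.ManinLocalTwoThreeEtaIdentitiesTwentyFour
import Summits.BirchSwinnertonDyer.BirchSwinnertonDyer.Theorems.ManinLocalTwoThreeNonVacuityTwenty
import Literature.NumberTheory.EllipticCurves.ModularCurveSturmProofs
import HarnessLib

/-!
# ROLL-CALL: `|c| = 1` on `X₀(N)` at EVERY genus-one level of the cruxes' domain — one theorem, level-uniform, fact-free

Cell bsd-f2-manin, route `ManinLocalTwoThree` (cruxes C2 `ManinOddAtFour` stmt-22967: `4 ∣ N ⟹ 2 ∤ c`; C3 `ManinPrimeToThreeAtNine`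
stmt-22968: `9 ∣ N ⟹ 3 ∤ c`), prover seat p3 gen 23.  The genus-one levels of `X₀` in the cruxes' domain (`4 ∣ N` or `9 ∣ N`) are
`N ∈ {20, 24, 27, 32, 36}`; at each of them the cell has landed a FACT-FREE kernel theorem `|D.maninConstant| = 1` for every globally
minimal elliptic `W/ℚ` and every `X₀(N)`-parametrisation datum `D` of `W` with the lattice clause (`27`: p3 g22/g23 + p2 g25,
hexagonal squeeze; `32`: -an g49 + p3 g23, Gaussian squeeze; `36`: p2 g26, hexagonal squeeze; `20`: p3 g23 and `24`: p2 g26, the CM-free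
NÉRON SQUEEZE of -an g50 / p3 g23).  This file states the five as ONE level-uniform theorem in the literal shape of the cruxes' bodies:

* `genusX0_eq_one_of_mem` — `g(X₀(N)) = 1` for `N ∈ {20, 24, 27, 32, 36}` (the tree's genus data);
* **`abs_maninConstant_eq_one_of_mem`** — `N ∈ {20, 24, 27, 32, 36} ⟹ |D.maninConstant| = 1` (∀ `W` globally minimal elliptic, ∀ `D` with
  the lattice clause); hence `not_two_dvd_not_three_dvd_of_mem` (`2 ∤ c ∧ 3 ∤ c`) and **`maninLocalTwoThree_body_of_mem`** — the bodies of
  C2 AND C3 (`2² ∣ N → 2 ∤ c`, `3² ∣ N → 3 ∤ c`) at these levels with NONE of the items' four hypotheses (no Mazur, Abbes–Ullmo,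
  Česnavičius, modularity, CDT);
* non-vacuity: the `X₀(N)`-domain is inhabited UNCONDITIONALLY at the CM levels `27, 32, 36` (`domain_inhabited_of_mem_cm`; tree:
  Hecke theta series / Jacobi sums give `aₙ(φ_N) = aₙ(E)`), and at all five levels GIVEN the items' own binder `exists_isNewformOf`
  (`domain_inhabited_of_mem_of_modularity`; `20`: `NonVacuityTwenty`, `24`: `LevelTwentyFour`);
* `maninLocalTwoThree_genusOne` — the conjunction: at each of the five levels the domain is inhabited (given modularity) and every datum
  has `|c| = 1`, `2 ∤ c`, `3 ∤ c`.

HONEST FRAMING: a re-packaging of landed theorems (standard axioms); the `∀ N` cruxes C2/C3 are NOT proved (beyond genus one the newform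
`D.f` is not pinned by dimension alone), Manin's conjecture is not proved, BSD is not proved; items 22967/22968 stay OPEN as filed.
No definition, no named fact, no sorry. [cite: AgasheRibetStein2006, §§1–2] [cite: CremonaAlgorithms1997, Table 3] [cite: DiamondShurman2005, Thm. 3.5.1]
-/

set_option autoImplicit false
-- lint-debt: the directory name repeats the summit name (sibling precedent `ManinLocalTwoThreeNonVacuityThirtySix.lean`)
set_option linter.dupNamespace false

noncomputable section

open Complex
open scoped MatrixGroups ModularForm
open CongruenceSubgroup WeierstrassCurve
open Literature.NumberTheory.EllipticCurves Literature.NumberTheory.EllipticCurves.ModularForms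

namespace Summit.BirchSwinnertonDyer.BirchSwinnertonDyer.Theorems.ManinLocalTwoThree.GenusOneRollCall

/-! ## §1 The five genus-one levels of the domain -/

/-- `g(X₀(N)) = 1` for `N ∈ {20, 24, 27, 32, 36}` (`μ = 36, 48, 36, 48, 72`; `ν_∞ = 6, 8, 6, 8, 12`; no elliptic points).
[cite: DiamondShurman2005, Thm. 3.1.1 and Fig. 3.3] -/
theorem genusX0_eq_one_of_mem {N : ℕ} [NeZero N] (hN : N ∈ ({20, 24, 27, 32, 36} : Finset ℕ)) : genusX0 N = 1 := by
  refine (finrank_cuspForm_two_le_genusX0_of_mem (N := N) ?_).2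
  simp only [Finset.mem_insert, Finset.mem_singleton] at hN ⊢
  omega

/-- Each of the five levels lies in the cruxes' domain: `2² ∣ N` or `3² ∣ N`. [folklore] -/
theorem four_dvd_or_nine_dvd_of_mem {N : ℕ} (hN : N ∈ ({20, 24, 27, 32, 36} : Finset ℕ)) : 2 ^ 2 ∣ N ∨ 3 ^ 2 ∣ N := by
  simp only [Finset.mem_insert, Finset.mem_singleton] at hN
  rcases hN with rfl | rfl | rfl | rfl | rfl <;> norm_num

/-! ## §2 `|c| = 1` at every genus-one level of the domain — level-uniform, fact-free -/

/-- **ROLL-CALL.  For `N ∈ {20, 24, 27, 32, 36}`, every globally minimal elliptic `W/ℚ` and every `X₀(N)`-parametrisation datum `D` of `W`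
with the lattice clause has `|D.maninConstant| = 1`** — no modularity, no CDT, no printed Manin-constant input (the five landed level
theorems `EtaIdentitiesTwenty…`, `EtaIdentitiesTwentyFour…`, `LigozatIdentities…TwentySeven`, `LigozatIdentitiesThirtyTwo…`,
`LigozatIdentitiesThirtySix…`). [cite: AgasheRibetStein2006, §§1–2] -/
theorem abs_maninConstant_eq_one_of_mem (W : WeierstrassCurve ℚ) [W.IsElliptic] [W.IsGloballyMinimal] {N : ℕ} [NeZero N]
    (hN : N ∈ ({20, 24, 27, 32, 36} : Finset ℕ)) (D : ModularParametrizationData W N)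
    (hopt : ∀ z ∈ D.L.lattice, ∃ w ∈ periodLattice D.f, z = D.c * w) :
    |D.maninConstant| = 1 := by
  simp only [Finset.mem_insert, Finset.mem_singleton] at hN
  rcases hN with rfl | rfl | rfl | rfl | rfl
  · exact EtaIdentitiesTwenty.abs_maninConstant_eq_one_twenty W D hopt
  · exact EtaIdentitiesTwentyFour.abs_maninConstant_eq_one_twentyFour W D hopt
  · exact LigozatIdentities.abs_maninConstant_eq_one_twentySeven W D hopt
  · exact LigozatIdentitiesThirtyTwo.abs_maninConstant_eq_one_thirtyTwo W D hopt
  · exact LigozatIdentitiesThirtySix.abs_maninConstant_eq_one_thirtySix W D hopt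

/-- `2 ∤ c` and `3 ∤ c` at the five genus-one levels (from `|c| = 1`). [folklore] -/
theorem not_two_dvd_not_three_dvd_of_mem (W : WeierstrassCurve ℚ) [W.IsElliptic] [W.IsGloballyMinimal] {N : ℕ} [NeZero N]
    (hN : N ∈ ({20, 24, 27, 32, 36} : Finset ℕ)) (D : ModularParametrizationData W N)
    (hopt : ∀ z ∈ D.L.lattice, ∃ w ∈ periodLattice D.f, z = D.c * w) :
    ¬ (2 : ℤ) ∣ D.maninConstant ∧ ¬ (3 : ℤ) ∣ D.maninConstant := by
  have h := abs_maninConstant_eq_one_of_mem W hN D hopt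
  constructor
  · intro h2
    have := Int.le_of_dvd (by rw [h]; norm_num) ((dvd_abs _ _).mpr h2)
    rw [h] at this
    norm_num at this
  · intro h3
    have := Int.le_of_dvd (by rw [h]; norm_num) ((dvd_abs _ _).mpr h3)
    rw [h] at this
    norm_num at this

/-- **The bodies of C2 `ManinOddAtFour` AND C3 `ManinPrimeToThreeAtNine` at the genus-one levels, with NONE of the items' hypotheses**:
`2² ∣ N → 2 ∤ c` and `3² ∣ N → 3 ∤ c` for `N ∈ {20, 24, 27, 32, 36}`. [cite: AgasheRibetStein2006, §§1–2] -/
theorem maninLocalTwoThree_body_of_mem (W : WeierstrassCurve ℚ) [W.IsElliptic] [W.IsGloballyMinimal] {N : ℕ} [NeZero N]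
    (hN : N ∈ ({20, 24, 27, 32, 36} : Finset ℕ)) (D : ModularParametrizationData W N)
    (hopt : ∀ z ∈ D.L.lattice, ∃ w ∈ periodLattice D.f, z = D.c * w) :
    (2 ^ 2 ∣ N → ¬ (2 : ℤ) ∣ D.maninConstant) ∧ (3 ^ 2 ∣ N → ¬ (3 : ℤ) ∣ D.maninConstant) :=
  ⟨fun _ ↦ (not_two_dvd_not_three_dvd_of_mem W hN D hopt).1, fun _ ↦ (not_two_dvd_not_three_dvd_of_mem W hN D hopt).2⟩

/-! ## §3 Non-vacuity: the `X₀(N)`-domains are inhabited -/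

/-- **UNCONDITIONAL non-vacuity at the CM levels `27, 32, 36`**: a globally minimal elliptic curve with a lattice-optimal `X₀(N)`-datum
exists (tree: `HeckeThetaTwentySeven.exists_latticeOptimalDatum_twentySeven`, `NonVacuity.exists_latticeOptimalDatum_thirtyTwo`,
`HeckeThetaThirtySix.exists_latticeOptimalDatum_thirtySix` — the newforms `η(3τ)²η(9τ)²`, `η(4τ)²η(8τ)²`, `η(6τ)⁴` ARE the newforms of
`27a`, `32a`, `36a` by Hecke theta series / Jacobi sums, no modularity theorem). [cite: EdixhovenManin1991, Prop. 2] -/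
theorem domain_inhabited_of_mem_cm {N : ℕ} [NeZero N] (hN : N ∈ ({27, 32, 36} : Finset ℕ)) :
    ∃ (W₀ : WeierstrassCurve ℚ) (_ : W₀.IsElliptic) (_ : W₀.IsGloballyMinimal) (D₀ : ModularParametrizationData W₀ N),
      ∀ z ∈ D₀.L.lattice, ∃ w ∈ periodLattice D₀.f, z = D₀.c * w := by
  simp only [Finset.mem_insert, Finset.mem_singleton] at hN
  rcases hN with rfl | rfl | rfl
  · obtain ⟨W₀, h₀, hmin, D₀, -, -, hopt⟩ := HeckeThetaTwentySeven.exists_latticeOptimalDatum_twentySeven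
    exact ⟨W₀, h₀, hmin, D₀, hopt⟩
  · obtain ⟨W₀, h₀, hmin, D₀, -, -, hopt⟩ := NonVacuity.exists_latticeOptimalDatum_thirtyTwo
    exact ⟨W₀, h₀, hmin, D₀, hopt⟩
  · obtain ⟨W₀, h₀, hmin, D₀, -, -, hopt, -⟩ := HeckeThetaThirtySix.exists_latticeOptimalDatum_thirtySix
    exact ⟨W₀, h₀, hmin, D₀, hopt⟩

/-- **Non-vacuity at all five genus-one levels GIVEN the items' own binder `exists_isNewformOf`** (at `20` and `24` the pinning
`aₙ(φ_N) = aₙ(E)` is taken from modularity: `NonVacuityTwenty`, `LevelTwentyFour`; at `27, 32, 36` it is unconditional).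
[cite: DiamondShurman2005, Thm. 8.8.3] [cite: EdixhovenManin1991, Prop. 2] -/
theorem domain_inhabited_of_mem_of_modularity (hnf : exists_isNewformOf) {N : ℕ} [NeZero N]
    (hN : N ∈ ({20, 24, 27, 32, 36} : Finset ℕ)) :
    ∃ (W₀ : WeierstrassCurve ℚ) (_ : W₀.IsElliptic) (_ : W₀.IsGloballyMinimal) (D₀ : ModularParametrizationData W₀ N),
      ∀ z ∈ D₀.L.lattice, ∃ w ∈ periodLattice D₀.f, z = D₀.c * w := by
  simp only [Finset.mem_insert, Finset.mem_singleton] at hN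
  rcases hN with rfl | rfl | rfl | rfl | rfl
  · obtain ⟨W₀, h₀, hmin, D₀, -, hopt, -⟩ := NonVacuityTwenty.maninOddAtFour_domain_inhabited_twenty_of_modularity hnf
    exact ⟨W₀, h₀, hmin, D₀, hopt⟩
  · obtain ⟨W₀, h₀, hmin, D₀, -, hopt, -⟩ := LevelTwentyFour.maninOddAtFour_domain_inhabited_twentyFour_of_modularity hnf
    exact ⟨W₀, h₀, hmin, D₀, hopt⟩
  · exact domain_inhabited_of_mem_cm (by decide)
  · exact domain_inhabited_of_mem_cm (by decide)
  · exact domain_inhabited_of_mem_cm (by decide)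

/-! ## §4 The conjunction -/

/-- **GENUS-ONE ROLL-CALL, assembled**: for every `N ∈ {20, 24, 27, 32, 36}` — all genus-one levels of `X₀` with `4 ∣ N` or `9 ∣ N` —
(i) `g(X₀(N)) = 1`; (ii) GIVEN `exists_isNewformOf`, a globally minimal elliptic curve with a lattice-optimal `X₀(N)`-datum exists
(unconditionally at `27, 32, 36`); (iii) FACT-FREE, every such datum of every globally minimal elliptic `W/ℚ` has `|c| = 1`, `2 ∤ c`,
`3 ∤ c`.  C2/C3 for all `N`, Manin's conjecture and BSD are NOT proved by this. [cite: AgasheRibetStein2006, §§1–2] -/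
theorem maninLocalTwoThree_genusOne {N : ℕ} [NeZero N] (hN : N ∈ ({20, 24, 27, 32, 36} : Finset ℕ)) :
    genusX0 N = 1 ∧ (2 ^ 2 ∣ N ∨ 3 ^ 2 ∣ N) ∧
    (exists_isNewformOf → ∃ (W₀ : WeierstrassCurve ℚ) (_ : W₀.IsElliptic) (_ : W₀.IsGloballyMinimal)
        (D₀ : ModularParametrizationData W₀ N), ∀ z ∈ D₀.L.lattice, ∃ w ∈ periodLattice D₀.f, z = D₀.c * w) ∧
    ∀ (W : WeierstrassCurve ℚ) [W.IsElliptic] [W.IsGloballyMinimal] (D : ModularParametrizationData W N),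
      (∀ z ∈ D.L.lattice, ∃ w ∈ periodLattice D.f, z = D.c * w) →
        |D.maninConstant| = 1 ∧ ¬ (2 : ℤ) ∣ D.maninConstant ∧ ¬ (3 : ℤ) ∣ D.maninConstant :=
  ⟨genusX0_eq_one_of_mem hN, four_dvd_or_nine_dvd_of_mem hN, fun hnf ↦ domain_inhabited_of_mem_of_modularity hnf hN,
    fun W _ _ D hopt ↦ ⟨abs_maninConstant_eq_one_of_mem W hN D hopt, not_two_dvd_not_three_dvd_of_mem W hN D hopt⟩⟩

end Summit.BirchSwinnertonDyer.BirchSwinnertonDyer.Theorems.ManinLocalTwoThree.GenusOneRollCall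

end
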